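import Mathlib
import Summits.Ventures.PercRepro.TriangleCapCellCount
import Summits.Ventures.PercRepro.TriangleCapRowsUnified
import Summits.Ventures.PercRepro.TriangleCapUniformArith

/-!
# PercRepro — THE `K₄⁻`-FREE CHERRY TABLE BELOW THE THRESHOLD, UNIFORMLY (p3, gen 33; part 25)

**THE UNIFORM THEOREM.**  For every `t ≥ 5` and every `k ≥ t + 3` at or below the threshold, `2k + t ≤ t² + 6`,
every `K₄⁻`-free graph with `k − 1 + t` edges on `k` vertices has `Σ_v C(d(v), 2) ≤ C(k − 2, 2) + C(t + 1, 2) + t + 1`,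
the cherry count of `K_{2,t+1}` plus `k − t − 3` pendant edges at one big vertex (`bipPend k t`), which attains it
(`rows_uniform_exact`).  With TriangleCapRowsUnified (the star value `C(k − 1, 2) + 2t` from the threshold on) the
table is **exact on every cell `k ≥ t + 3`, `t ≥ 5`: the maximum is `max(star, bipPend)`** (`table_exact`) — the
census observation of gen 32 (mining/p3/g32/census_vs_two_families) as one theorem, and the rows `t = 5 … 9`
(TriangleCapRowPlusFour … RowPlusSeven, cell by cell) as special cases.

The proof is the cell template of TriangleCapSevenTen on the packaged count `cell_count` (TriangleCapCellCount), with
the case analysis done once, symbolically, in TriangleCapUniformArith: all degrees `≤ 4` (the cap `3m`); else at a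
vertex of maximum degree `d` with `g = k − 1 − d` non-neighbours the count needs `Y ≥ 2T + 4(g − 1)(t + 2 − d)` —
the dominating vertex (`T = 2t`, `T² ≤ 2Y + 2T`, the threshold), `d ≥ t + 2` (the matching pairs, `Y ≥ (t − 1)T`),
and `5 ≤ d ≤ t + 1` (`key_arith`: the split sum for `δ ≤ 3` and when `(2m′ − d)(m′ + 1 − 2δ) ≥ 4(g − 1)a`,
else the defect sum `4(m′ − δ)(δ − 2) = (m′ − 1 + P)(m′ − 3 − P)`, which is `(g + t − 2 − 2a)² + Γ` with
`Γ = 4at − 4a² − 2a − 2t − 5 − 2P − P²`, and `Γ < 0` only for `t ≤ 10` — enumerated).  Axioms: standard.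
-/

namespace PercRepro

namespace TriangleCap

namespace C047

open Finset

variable {V : Type*} [Fintype V] [DecidableEq V]

/-- **THE UNIFORM THEOREM BELOW THE THRESHOLD:** for `t ≥ 5`, `k ≥ t + 3` and `2k + t ≤ t² + 6`, every `K₄⁻`-free
graph `D` with `k − 1 + t` edges on `k` vertices has `Σ_v C(d(v), 2) ≤ C(k − 2, 2) + C(t + 1, 2) + t + 1`. -/
theorem cherries_le_bipPend_value_of_k4mFree (t : ℕ) (ht : 5 ≤ t) (D : SimpleGraph V) [DecidableRel D.Adj]
    (hK : K4mFree D) (hk3 : t + 3 ≤ Fintype.card V) (hk : 2 * Fintype.card V + t ≤ t * t + 6)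
    (hm : D.edgeFinset.card + 1 = Fintype.card V + t) :
    cherries D ≤ (Fintype.card V - 2).choose 2 + (t + 1).choose 2 + t + 1 := by
  by_cases hdeg : ∀ v, deg D v ≤ 4
  · -- every degree `≤ 4`: `cherries ≤ 3m ≤ C(k − 2, 2) + C(t + 1, 2) + t + 1`
    have h3 := cherries_le_three_mul_of_deg_le_four D hdeg
    obtain ⟨j, hj⟩ : ∃ j, Fintype.card V = t + 3 + j := ⟨Fintype.card V - (t + 3), by omega⟩
    rw [hj] at hm ⊢
    have hcap := Uniform.cap_arith t j ht
    have e1 : t + 3 + j - 2 = t + 1 + j := by omega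
    rw [e1]
    have e2 : D.edgeFinset.card = 2 * t + 2 + j := by omega
    rw [e2] at h3
    omega
  · push Not at hdeg
    obtain ⟨u, hu⟩ := hdeg
    obtain ⟨v, hmax, hv⟩ := exists_max_deg D (by omega : 5 ≤ deg D u)
    obtain ⟨T, M, Rc, Y, Ec, δ, hTM, hT, hTT, hRc, hEc, hdom, hdk, hδd, hδ1, hL, hfin⟩ :=
      cell_count D hK v hmax
    set d := deg D v with hddef
    set ch := cherries D with hchdef
    set k := Fintype.card V with hkdef
    set m := D.edgeFinset.card with hmdef
    clear_value d ch k m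
    clear hddef hchdef hkdef hmdef hmax hu
    obtain ⟨g, hg⟩ : ∃ g, k = d + 1 + g := ⟨k - (d + 1), by omega⟩
    subst hg
    have hm' : m = d + g + t := by omega
    subst hm'
    have hRc' : Rc = 2 * (g + t) := by omega
    subst hRc'
    have hEc' : Ec = g + t := by omega
    subst hEc'
    have e1 : d + 1 + g - 2 = d + g - 1 := by omega
    rw [e1]
    apply Uniform.final_arith ch d g t T Y (2 * (g + t)) (d + g + t) (by omega) rfl rfl hfin
    have hSS : T * (t - 1) + (2 * (g + t) - T) * (g + t + 1 - 2 * δ) ≤ Y := by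
      have e : g + t + d - (d + 1 + g) = t - 1 := by omega
      rw [e] at hL
      exact hL
    rcases Nat.eq_zero_or_pos g with hg0 | hg1
    · -- the dominating vertex: `T = |R| = 2t`, `T² ≤ 2Y + 2T`, the threshold
      subst hg0
      have hT2 : T = 2 * t := by
        have := hdom (by omega)
        omega
      have h := Uniform.dom_arith t d T Y hT2 hTT (by omega)
      have h' : (4 * d : ℤ) ≤ Y + 8 := by exact_mod_cast h
      have hT2' : (T : ℤ) = 2 * t := by exact_mod_cast hT2
      push_cast
      linarith
    · have hg1' : 1 ≤ g := hg1
      rcases Nat.lt_or_ge (t + 1) d with hd | hd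
      · -- `d ≥ t + 2`: the constant is `≤ 0`, `Y ≥ (t − 1)T ≥ 2T`
        have h2T := Uniform.two_mul_le_of_split t T Y _ (by omega) hSS
        have h2T' : (2 * T : ℤ) ≤ Y := by exact_mod_cast h2T
        have hprod : (0 : ℤ) ≤ ((g : ℤ) - 1) * ((d : ℤ) - (t + 2)) :=
          mul_nonneg (by linarith [(by exact_mod_cast hg1' : (1 : ℤ) ≤ g)])
            (by linarith [(by exact_mod_cast hd : (t : ℤ) + 1 < d)])
        nlinarith [hprod, h2T']
      · -- `5 ≤ d ≤ t + 1`: the key inequality with `a = t + 2 − d`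
        obtain ⟨a, ha⟩ : ∃ a, t + 2 = d + a := ⟨t + 2 - d, by omega⟩
        have hDS : 4 * ((g + t - δ) * (δ - 2)) ≤ Y := by
          rcases Nat.lt_or_ge δ 2 with hδ2 | hδ2
          · have e : δ - 2 = 0 := by omega
            rw [e, mul_zero, mul_zero]
            exact Nat.zero_le _
          · exact four_mul_le_of_halves (g + t) δ Y hδ1 hδ2
        have hkey := Uniform.key_arith t a g δ T Y ht (by omega) (by omega) hg1' (by omega) (by omega) hDS hSS
        have ha' : (a : ℤ) = t + 2 - d := by omega
        zify [hg1'] at hkey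
        rw [ha'] at hkey
        linarith

/-- **THE ROWS BELOW THE THRESHOLD, EXACT:** for `t ≥ 5`, `k ≥ t + 3` and `2k + t ≤ t² + 6` the `K₄⁻`-free cherry
maximum at `(k, k − 1 + t)` is exactly `C(k − 2, 2) + C(t + 1, 2) + t + 1`, attained by `K_{2,t+1}` plus `k − t − 3`
pendant edges at one big vertex (`bipPend k t`). -/
theorem rows_uniform_exact (t k : ℕ) (ht : 5 ≤ t) (hk3 : t + 3 ≤ k) (hk : 2 * k + t ≤ t * t + 6) :
    (∀ (D : SimpleGraph (Fin k)) [DecidableRel D.Adj], K4mFree D → D.edgeFinset.card + 1 = k + t →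
        cherries D ≤ (k - 2).choose 2 + (t + 1).choose 2 + t + 1) ∧
      ∃ (D : SimpleGraph (Fin k)) (_ : DecidableRel D.Adj),
        K4mFree D ∧ D.edgeFinset.card + 1 = k + t ∧
          cherries D = (k - 2).choose 2 + (t + 1).choose 2 + t + 1 := by
  refine ⟨fun D _ hK hD => ?_, bipPend k t, inferInstance, k4mFree_bipPend k t, card_edges_bipPend k t hk3,
    cherries_bipPend k t hk3⟩
  have := cherries_le_bipPend_value_of_k4mFree t ht D hK (by simpa using hk3) (by simpa using hk)
    (by rw [hD]; simp)
  simpa using this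

/-- The two candidate values: at or below the threshold the bipartite value is the larger, at or above it the star
value is (`2·(bipPend − star) = t² − t + 6 − 2k`). -/
theorem star_le_bipPend_value (t k : ℕ) (hk3 : t + 3 ≤ k) (hk : 2 * k + t ≤ t * t + 6) :
    (k - 1).choose 2 + 2 * t ≤ (k - 2).choose 2 + (t + 1).choose 2 + t + 1 := by
  obtain ⟨K, rfl⟩ : ∃ K, k = K + 2 := ⟨k - 2, by omega⟩
  have e1 : K + 2 - 1 = K + 1 := by omega
  have e2 : K + 2 - 2 = K := by omega
  rw [e1, e2]
  have h1 := Uniform.two_mul_choose_two_add' (K + 1)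
  have h2 := Uniform.two_mul_choose_two_add' K
  have h3 := Uniform.two_mul_choose_two_add' (t + 1)
  nlinarith [h1, h2, h3, hk]

/-- At or above the threshold the star value is the larger. -/
theorem bipPend_value_le_star (t k : ℕ) (hk3 : t + 3 ≤ k) (hk : t * t + 6 ≤ 2 * k + t) :
    (k - 2).choose 2 + (t + 1).choose 2 + t + 1 ≤ (k - 1).choose 2 + 2 * t := by
  obtain ⟨K, rfl⟩ : ∃ K, k = K + 2 := ⟨k - 2, by omega⟩
  have e1 : K + 2 - 1 = K + 1 := by omega
  have e2 : K + 2 - 2 = K := by omega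
  rw [e1, e2]
  have h1 := Uniform.two_mul_choose_two_add' (K + 1)
  have h2 := Uniform.two_mul_choose_two_add' K
  have h3 := Uniform.two_mul_choose_two_add' (t + 1)
  nlinarith [h1, h2, h3, hk]

/-- **THE TABLE AS ONE INEQUALITY:** for `t ≥ 5` and `k ≥ t + 3`, every `K₄⁻`-free graph with `k − 1 + t` edges on
`k` vertices has `Σ_v C(d(v), 2) ≤ max (C(k − 1, 2) + 2t) (C(k − 2, 2) + C(t + 1, 2) + t + 1)` — the larger of the
star-plus-matching and the `K_{2,t+1}`-plus-pendants values. -/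
theorem cherries_le_max_of_k4mFree (t : ℕ) (ht : 5 ≤ t) (D : SimpleGraph V) [DecidableRel D.Adj]
    (hK : K4mFree D) (hk3 : t + 3 ≤ Fintype.card V) (hm : D.edgeFinset.card + 1 = Fintype.card V + t) :
    cherries D ≤ max ((Fintype.card V - 1).choose 2 + 2 * t)
      ((Fintype.card V - 2).choose 2 + (t + 1).choose 2 + t + 1) := by
  rcases le_or_gt (t * t + 6) (2 * Fintype.card V + t) with h | h
  · exact (cherries_le_star_value t (by omega) D hK h hm).trans (le_max_left _ _)
  · exact (cherries_le_bipPend_value_of_k4mFree t ht D hK hk3 h.le hm).trans (le_max_right _ _)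

/-- **THE `K₄⁻`-FREE CHERRY TABLE ON EVERY CELL `k ≥ t + 3`, `t ≥ 5`, EXACT:** the maximum of `Σ_v C(d(v), 2)` over
`K₄⁻`-free graphs with `k − 1 + t` edges on `k` vertices is `max (C(k − 1, 2) + 2t) (C(k − 2, 2) + C(t + 1, 2) + t + 1)`,
attained by the star plus `t` disjoint leaf edges at or above the threshold `2k + t = t² + 6` and by `K_{2,t+1}` plus
`k − t − 3` pendant edges at or below it. -/
theorem table_exact (t k : ℕ) (ht : 5 ≤ t) (hk3 : t + 3 ≤ k) :
    (∀ (D : SimpleGraph (Fin k)) [DecidableRel D.Adj], K4mFree D → D.edgeFinset.card + 1 = k + t →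
        cherries D ≤ max ((k - 1).choose 2 + 2 * t) ((k - 2).choose 2 + (t + 1).choose 2 + t + 1)) ∧
      ∃ (D : SimpleGraph (Fin k)) (_ : DecidableRel D.Adj),
        K4mFree D ∧ D.edgeFinset.card + 1 = k + t ∧
          cherries D = max ((k - 1).choose 2 + 2 * t) ((k - 2).choose 2 + (t + 1).choose 2 + t + 1) := by
  refine ⟨fun D _ hK hD => ?_, ?_⟩
  · have := cherries_le_max_of_k4mFree t ht D hK (by simpa using hk3) (by rw [hD]; simp)
    simpa using this
  · rcases le_or_gt (t * t + 6) (2 * k + t) with h | h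
    · have h2 : 2 * t + 1 ≤ k := by nlinarith [h, ht]
      obtain ⟨D, inst, hK, hD, hc⟩ := (rows_exact t k (by omega) h h2).2
      refine ⟨D, inst, hK, hD, ?_⟩
      rw [hc, max_eq_left (bipPend_value_le_star t k hk3 h)]
    · refine ⟨bipPend k t, inferInstance, k4mFree_bipPend k t, card_edges_bipPend k t hk3, ?_⟩
      rw [cherries_bipPend k t hk3, max_eq_right (star_le_bipPend_value t k hk3 h.le)]
      ring

end C047

end TriangleCap

end PercRepro
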